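import Literature.Analysis.FluidPDE.Wei2016Continuation
import HarnessLib

/-!
# Wei 2016, Cor. 1.1: the a-priori enstrophy bound as a named fact, and the assembly

Analysis/FluidPDE. Fact decomposition (librarian, 2026-08-16) of the named fact
`Literature.Analysis.FluidPDE.Wei2016_logModulus_regularity`
(`LeiZhang2017AxisymmetricCriteria.lean`; D. Wei, *Regularity criterion to the axially symmetric
Navier–Stokes equations*, J. Math. Anal. Appl. 435 (2016) 402–413 = arXiv:1508.03318, Cor. 1.1:
a strong axisymmetric solution with `|Γ| ≤ |ln r|^{-3/2}` near the axis is regular globally in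
time).

The printed proof is an A-PRIORI ESTIMATE for the strong solution ("we only need to prove
`Ω ∈ L^∞(0, T*; L²(ℝ³))`", §1 p. 4; §3: Lemmas 2.1–2.3, the energy inequalities (3.1)–(3.7) for
the quotients `J` and `Ω = ω_θ/r`, and the comparison with `F`) followed by the standard continuation
argument. The tree PROVES the continuation end-game
(`Wei2016_logModulus_regularity_of_enstrophy_apriori`, `Wei2016Continuation.lean`: Prodi–Serrin
weak–strong uniqueness, the continuation method in Tao's smooth class, the `H¹` continuation
criterion) and large parts of the estimate (`Wei2016HardyLemma`, `Wei2016HardyCutoff`,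
`Wei2016Lemma22`, `Wei2016Lemma23`, `Wei2016SupLemma`, `Wei2016Slice*`, `Wei2016EnergyBalanceA`,
`Wei2016AprioriA` — the integrated `F`-comparison `IsTaoSolutionOn.F_energyA_le` —,
`Wei2016DissipationBound`, `Wei2016EndgameBalances`, …), leaving as the single unproved input the
a-priori bound itself in the exact form the end-game consumes. It is named here (D-0014 named
fact; one child only, because the corollary has exactly one unproved input):

* `Wei2016_aprioriEnstrophy_logModulus` — **the a-priori `H¹` bound under (1.6)**: hypothesis `hA`
  of `Wei2016_logModulus_regularity_of_enstrophy_apriori`, verbatim;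
* `Wei2016_logModulus_regularity_holds_of` — the assembly (one line).

## References

* D. Wei, J. Math. Anal. Appl. 435 (2016) 402–413, arXiv:1508.03318: Thm. 1.1, Cor. 1.1, §1 p. 4,
  §2 Lemmas 2.1–2.3, §3 (3.1)–(3.7). [Wei2016]
* T. Tao, Anal. PDE 6 (2013) = arXiv:1108.1165, Thm. 5.4 (the smooth `H^∞` class). [Tao2011]
-/

noncomputable section

open MeasureTheory Set Function Filter Topology
open scoped ENNReal NNReal ContDiff

namespace Literature.Analysis.FluidPDE

/-- **Wei 2016, the a-priori enstrophy bound behind Cor. 1.1** (arXiv:1508.03318, §1 p. 4: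
"global regularity means `T* = +∞`, and we only need to prove `Ω ∈ L^∞(0, T*; L²(ℝ³))`"; proof
of Thm. 1.1 / Cor. 1.1, §3: under `|Γ(r, z, t)| ≤ |ln r|^{-3/2}` for `0 < r ≤ δ₀` the quantity
`A(t) = ‖J(t)‖² + ½ε^{2/3}‖Ω(t)‖²` obeys `d/dt F(A) ≥ -C M₂ ‖∇u‖²`, whence `A`, `‖Ω‖_{L²}` and
the `H¹` norm stay bounded on the existence interval). Rendered in Tao's smooth class
(`IsTaoSolutionOn`, the tree's strong-solution framework): for `δ₀ ∈ (0, 1/2)`, `T > 0` and every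
smooth, divergence-free, rapidly decaying (`H^∞`), axisymmetric datum `u₀` with `Γ₀ ∈ L^∞`, there
is `K ≥ 0` such that every Tao-class solution `v` of Navier–Stokes (`ν = 1`, no force) from `u₀`
on `[0, T'] ⊆ [0, T]` with axisymmetric slices obeying the log-modulus bound (1.6),
`|Γ_v(t, x)| ≤ |log r|^{-3/2}` for `t ∈ [0, T')`, `0 < r = cylRadius x ≤ δ₀`, satisfies
`∫ ‖Dv(t)‖² ≤ K` for all `t ∈ [0, T']`. This is hypothesis `hA` of
`Wei2016_logModulus_regularity_of_enstrophy_apriori` (`Wei2016Continuation.lean`), verbatim; its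
ingredients Lemmas 2.1–2.3 and the integrated `F`-comparison are theorems of the sibling files
(`Wei2016HardyLemma`, `Wei2016Lemma23`, `Wei2016AprioriA`, …). [cite: Wei2016, §3 (proof of Thm. 1.1 and Cor. 1.1) and §1 p. 4] -/
def Wei2016_aprioriEnstrophy_logModulus : Prop :=
  ∀ ⦃δ₀ : ℝ⦄, 0 < δ₀ → δ₀ < 1 / 2 → ∀ ⦃T : ℝ⦄, 0 < T →
    ∀ ⦃u₀ : EuclideanSpace ℝ (Fin 3) → EuclideanSpace ℝ (Fin 3)⦄,
      ContDiff ℝ ∞ u₀ → VectorCalculus.IsDivFree u₀ → HasRapidSpatialDecay u₀ →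
      (∀ n : ℕ, ∫⁻ x, ‖iteratedFDeriv ℝ n u₀ x‖ₑ ^ 2 < ⊤) → IsAxisymmetric u₀ →
      eLpNorm (swirl u₀) ⊤ volume < ⊤ →
      ∃ K : ℝ, 0 ≤ K ∧ ∀ ⦃T' : ℝ⦄, 0 < T' → T' ≤ T →
        ∀ ⦃v : ℝ → EuclideanSpace ℝ (Fin 3) → EuclideanSpace ℝ (Fin 3)⦄
          ⦃q : ℝ → EuclideanSpace ℝ (Fin 3) → ℝ⦄,
          IsTaoSolutionOn T' 1 u₀ v q →
          (∀ t ∈ Icc 0 T', IsAxisymmetric (v t)) →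
          (∀ t ∈ Ico 0 T', ∀ x : EuclideanSpace ℝ (Fin 3), 0 < cylRadius x →
              cylRadius x ≤ δ₀ → |swirl (v t) x| ≤ |Real.log (cylRadius x)| ^ (-(3 / 2 : ℝ))) →
          ∀ t ∈ Icc 0 T', ∫⁻ x, ‖iteratedFDeriv ℝ 1 (v t) x‖ₑ ^ 2 ≤ ENNReal.ofReal K

/-- **Assembly of Wei 2016, Cor. 1.1**: the named fact `Wei2016_logModulus_regularity` follows from
the a-priori enstrophy bound `Wei2016_aprioriEnstrophy_logModulus` — by
`Wei2016_logModulus_regularity_of_enstrophy_apriori` (weak–strong uniqueness, continuation in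
Tao's class and the `H¹` continuation criterion, theorems of the tree). [cite: Wei2016, Cor. 1.1 and §1 p. 4] -/
theorem Wei2016_logModulus_regularity_holds_of (hA : Wei2016_aprioriEnstrophy_logModulus) :
    Wei2016_logModulus_regularity :=
  Wei2016_logModulus_regularity_of_enstrophy_apriori hA

end Literature.Analysis.FluidPDE

end
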